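import Summits.CriticalPhenomena.PercolationContinuityZ3.Theorems.Transplant.FKConnectivityAllQForestTwoCellArrowSteps
import Summits.CriticalPhenomena.PercolationContinuityZ3.Theorems.Transplant.FKConnectivityAllQForestSeriesEnd
import Summits.CriticalPhenomena.PercolationContinuityZ3.Theorems.Transplant.FKConnectivityAllQForestTreeLevel
import Summits.CriticalPhenomena.PercolationContinuityZ3.Theorems.Transplant.FKConnectivityAllQForestAdjacentTriangle
import HarnessLib

/-!
# CONJECTURE H1′ IMPLIES THE SQUARE-FREE ADJACENT FOREST RAYLEIGH NODE: `TwoCellBoundOn V → AdjForestRayleighNoSqOn V` (part 2 of 2)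

Support file (`--supports stmt-CriticalPhenomena-4575`), FK sub-lane `prim-bschramm-fk-1` (generation 30) of the post-continuity
programme; builds on p205010 (kernel theorem, internal audit signed; external expert review pending).  No definitions, no named facts,
no sorries; standard axioms.

THE ARROW (memo bschramm/FROM-fk-1-g30-LAMAN-IDENTITIES.md §4).  Strong induction on the size of a support `S` of the fibre `(M, u₀)`:
(0) `e` or `f` not free ⇒ trivial (as in g29's tree level); (1) at or above the tight level ⇒ the TREE LEVEL (`adjForestNoSq_fibre_of_tight`,
g29); (2) a far vertex of weighted degree ≤ 2 ⇒ level-free eliminations (**`node_of_farVertex_le_two`**: isolated / pendant free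
(`fibreCount_forest_pendantFree`) / two free (`twoCellBound_step_degTwo`) / pendant pinned (**`node_step_pendant`**)); (3) the hub of
weighted degree two ⇒ `adjForestNoSq_fibre_of_hubDegTwo`; an end `v` or `y` of weighted degree ≤ 2 ⇒ `adjForestNoSq_bad_eq_good_of_pendantEnd`
or the SERIES REDUCTION `adjForestNoSq_fibre_of_seriesEnd` (or the triangle theorem when the end is joined to the other end);
(4) otherwise every vertex of `S` has weighted degree ≥ 3 and the COUNTING LEMMA (**`exists_deg_three_not_adj_hub`**: below the tight level
`Σ wdeg ≤ 4|S| − 6`, so the weighted-degree-3 vertices cannot all be joined to `o`) yields a vertex `z ∉ {o, v, y}` of weighted degree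
3 not joined to `o`; it is mixed (one free + one pinned pair: **`node_step_mixed`**, two pair cells) or carries three free pairs — and
there, and only there, CONJECTURE H1′ (`TwoCellBoundOn V`, via `twoCellBound_step_claw`) is used (**`node_of_farVertex_three`**).
Main results: **`adjForestRayleighNoSqOn_of_twoCellBound`**, **`adjForestRayleighNoSqPos_of_twoCellBoundPos`**.
[cite: CibulkaHladkyLaCroixWagner2008, Thm. 1 (p. 2), Cases 0–3 (pp. 4–5)] [cite: SempleWelsh2008, Conj. 1.1 (p. 2); Thm. 4.2 (p. 11)]
[cite: Linusson2011, Prop. 2.6] [cite: Grimmett2006, §1.5 (p. 13)]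
-/

noncomputable section

namespace Summit.CriticalPhenomena.PercolationContinuityZ3.Theorems
namespace FK

open MeasureTheory Set Literature.Probability.LatticeModels Literature.Probability.Percolation
open scoped Classical symmDiff

variable {V : Type*} [Fintype V]
/-! ### Counting: a weighted-degree-3 vertex not joined to the hub -/

section Count

omit [Fintype V] in
/-- **Counting lemma.**  If every vertex of `S` has weight at least `3`, the total weight is at most `4|S| − 6`, and the vertices of
weight exactly `3` other than `o` all lie in a set `nbr` of size at most the weight of `o`, we get a contradiction; hence some vertex
`z ≠ o` of weight `3` lies outside `nbr`. [folklore] -/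
theorem exists_weight_three_outside (S nbr : Finset V) (o : V) (f : V → ℕ) (hoS : o ∈ S) (hdeg : ∀ w ∈ S, 3 ≤ f w)
    (hsum : ∑ w ∈ S, f w + 6 ≤ 4 * S.card) (hnbr : nbr.card ≤ f o) :
    ∃ z ∈ S, z ≠ o ∧ f z = 3 ∧ z ∉ nbr := by
  by_contra hcon
  push Not at hcon
  have hDsub : (S.erase o).filter (fun w => f w = 3) ⊆ nbr := by
    intro z hz
    rw [Finset.mem_filter, Finset.mem_erase] at hz
    exact hcon z hz.1.2 hz.1.1 hz.2
  have hDcard : ((S.erase o).filter (fun w => f w = 3)).card ≤ f o := (Finset.card_le_card hDsub).trans hnbr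
  have hsplit := Finset.sum_filter_add_sum_filter_not (S.erase o) (fun w => f w = 3) f
  have h3 : ∑ w ∈ (S.erase o).filter (fun w => f w = 3), f w = 3 * ((S.erase o).filter (fun w => f w = 3)).card := by
    rw [Finset.sum_congr rfl (fun w hw => (Finset.mem_filter.1 hw).2), Finset.sum_const, smul_eq_mul, mul_comm]
  have h4 := Finset.card_nsmul_le_sum ((S.erase o).filter fun w => ¬ f w = 3) f 4 (fun w hw => by
      have hw' := Finset.mem_filter.1 hw
      have := hdeg w (Finset.mem_of_mem_erase hw'.1)
      omega)
  rw [smul_eq_mul] at h4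
  have h4' : ((S.erase o).filter fun w => ¬ f w = 3).card * 4 ≤ ∑ w ∈ (S.erase o).filter (fun w => ¬ f w = 3), f w := h4
  have hcardsplit := Finset.card_filter_add_card_filter_not (s := S.erase o) (fun w => f w = 3)
  have hcardE : (S.erase o).card + 1 = S.card := Finset.card_erase_add_one hoS
  have hsumS : ∑ w ∈ S, f w = f o + ∑ w ∈ S.erase o, f w := (Finset.add_sum_erase S f hoS).symm
  have e1 : ∑ w ∈ S.erase o, f w = 3 * ((S.erase o).filter (fun w => f w = 3)).card +
      ∑ w ∈ (S.erase o).filter (fun w => ¬ f w = 3), f w := by rw [← h3, hsplit]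
  have e2 : ((S.erase o).filter (fun w => ¬ f w = 3)).card = (S.erase o).card - ((S.erase o).filter (fun w => f w = 3)).card := by
    omega
  rw [e2] at h4'
  omega

end Count

/-! ### The main induction -/

section Main

variable {M u₀ : BondConfig V} {S : Finset V} {o v y : V}

/-- **An end of weighted degree at most two** (`v` carries `e` and at most one more free pair): pendant end (bad = good), triangle
(the other pair is `vy`), or the series reduction. [cite: CibulkaHladkyLaCroixWagner2008, Case 2(ii) (p. 4)] [cite: Linusson2011, Prop. 2.6] -/
theorem node_of_lowEnd
    (IH : ∀ (N u : BondConfig V), Disjoint u N → (∀ g ∈ N ∪ u, ∀ w ∈ g, w ∈ S.erase v) →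
      ∀ (v' : V), v' ≠ y →
      fibreCount N u (forestEv V ∩ {ω | s(o, v') ∈ ω ∧ s(o, y) ∈ ω}) (forestEv V) ≤
        fibreCount N u (forestEv V ∩ {ω | s(o, v') ∈ ω}) (forestEv V ∩ {ω | s(o, y) ∈ ω}))
    (hd : Disjoint u₀ M) (hS : ∀ g ∈ M ∪ u₀, ∀ w ∈ g, w ∈ S) (hdiag : ∀ g ∈ M ∪ u₀, ¬ g.IsDiag)
    (heM : s(o, v) ∈ M) (hfM : s(o, y) ∈ M) (hov : o ≠ v) (hoy : o ≠ y) (hvy : v ≠ y)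
    (hdv : ((toFinite M).toFinset.filter fun g => v ∈ g).card + 2 * ((toFinite u₀).toFinset.filter fun g => v ∈ g).card ≤ 2) :
    fibreCount M u₀ (forestEv V ∩ {ω | s(o, v) ∈ ω ∧ s(o, y) ∈ ω}) (forestEv V) ≤
      fibreCount M u₀ (forestEv V ∩ {ω | s(o, v) ∈ ω}) (forestEv V ∩ {ω | s(o, y) ∈ ω}) := by
  have hMd : ∀ g ∈ M, ¬ g.IsDiag := fun g hg => hdiag g (Or.inl hg)
  have hef : s(o, v) ≠ s(o, y) := fun h' => hvy (Sym2.congr_right.1 h')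
  -- the triangle case
  by_cases hvyM : s(v, y) ∈ M ∪ u₀
  · exact adjForestNoSq_fibre_of_triangle hd hvy hvyM
  have h1v : 1 ≤ ((toFinite M).toFinset.filter fun g => v ∈ g).card :=
    Finset.card_pos.2 ⟨s(o, v), Finset.mem_filter.2 ⟨(Set.Finite.mem_toFinset _).2 heM, Sym2.mem_mk_right _ _⟩⟩
  have hUv := isolated_of_card_filter_eq_zero (M := u₀) (z := v) (by omega)
  rcases Nat.lt_or_ge ((toFinite M).toFinset.filter fun g => v ∈ g).card 2 with h1 | h2
  · -- pendant end
    obtain ⟨c, -, hvcM, honly⟩ := exists_of_card_filter_eq_one (z := v) hMd (by omega)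
    have hce : s(v, c) = s(o, v) := by
      have := honly _ heM (Sym2.mem_mk_right _ _); exact this.symm
    have hv : ∀ g ∈ M ∪ u₀, v ∈ g → g = s(o, v) := fun g hg hvg =>
      hg.elim (fun hg => (honly g hg hvg).trans hce) (fun hg => absurd hvg (hUv g hg))
    exact (adjForestNoSq_bad_eq_good_of_pendantEnd hov heM hef hv).le
  · -- `e` and one more free pair `g = vw`
    obtain ⟨a, b, hva, hvb, hab, haM, hbM, honly⟩ := exists_of_card_filter_eq_two (z := v) hMd (by omega)
    -- one of the two pairs is `e`
    obtain ⟨w, hvw, hgM, hge, honly'⟩ : ∃ w, v ≠ w ∧ s(v, w) ∈ M ∧ s(v, w) ≠ s(o, v) ∧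
        ∀ g ∈ M, v ∈ g → g = s(o, v) ∨ g = s(v, w) := by
      rcases honly _ heM (Sym2.mem_mk_right _ _) with he | he
      · refine ⟨b, hvb, hbM, fun h => hab ?_, fun g hg hvg => (honly g hg hvg).imp (fun h => h.trans he.symm) id⟩
        have := h.trans he; exact (Sym2.congr_right.1 this).symm
      · refine ⟨a, hva, haM, fun h => hab ?_, fun g hg hvg => (honly g hg hvg).symm.imp (fun h => h.trans he.symm) id⟩
        have := h.trans he; exact Sym2.congr_right.1 this
    have how : o ≠ w := fun h => hge (by rw [← h, Sym2.eq_swap])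
    have hwy : w ≠ y := fun h => hvyM (Or.inl (h ▸ hgM))
    have hwS : w ∈ S := hS _ (Or.inl hgM) w (Sym2.mem_mk_right _ _)
    have hoS : o ∈ S := hS _ (Or.inl heM) o (Sym2.mem_mk_left _ _)
    set M₁ := M \ {s(v, w)} with hM₁
    have hgM₁ : s(v, w) ∉ M₁ := fun h => h.2 rfl
    have hMeq : insert s(v, w) M₁ = M := by rw [hM₁, insert_sdiff_singleton, insert_eq_of_mem hgM]
    have heM₁ : s(o, v) ∈ M₁ := ⟨heM, fun h => hge (mem_singleton_iff.1 h).symm⟩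
    have hv : ∀ p ∈ M₁ ∪ u₀, v ∈ p → p = s(o, v) := by
      intro p hp hvp
      rcases hp with hp | hp
      · rcases honly' p hp.1 hvp with h | h
        · exact h
        · exact absurd h (fun h' => hp.2 (mem_singleton_iff.2 h'))
      · exact absurd hvp (hUv p hp)
    have hd' : Disjoint u₀ (insert s(v, w) M₁) := by rw [hMeq]; exact hd
    -- supports of the reduced fibres lie in `S ∖ v`
    have hnotv : ∀ p ∈ M₁ \ {s(o, v)} ∪ u₀, v ∉ p := by
      intro p hp hvp
      rcases hp with hp | hp
      · exact hp.2 (hv p (Or.inl hp.1) hvp)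
      · exact hUv p hp hvp
    have howS : ∀ x ∈ s(o, w), x ∈ S.erase v := by
      intro x hx
      rcases Sym2.mem_iff.1 hx with rfl | rfl
      · exact Finset.mem_erase.2 ⟨hov, hoS⟩
      · exact Finset.mem_erase.2 ⟨hvw.symm, hwS⟩
    rw [← hMeq]
    refine adjForestNoSq_fibre_of_seriesEnd hov hvw how hwy hvy heM₁ hgM₁ hd' hv (fun hhM hhu => ?_) (fun hhM => ?_)
    · refine IH _ _ (Set.disjoint_insert_right.2 ⟨hhu, hd.mono_right (sdiff_subset.trans sdiff_subset)⟩) ?_ w hwy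
      intro p hp x hx
      rcases hp with hp | hp
      · rcases mem_insert_iff.1 hp with rfl | hp
        · exact howS x hx
        · exact Finset.mem_erase.2 ⟨fun h => hnotv p (Or.inl hp) (h ▸ hx), hS p (Or.inl hp.1.1) x hx⟩
      · exact Finset.mem_erase.2 ⟨fun h => hnotv p (Or.inr hp) (h ▸ hx), hS p (Or.inr hp) x hx⟩
    · have hsub : M₁ \ {s(o, v), s(o, w)} ⊆ M₁ \ {s(o, v)} := sdiff_subset_sdiff_right (singleton_subset_iff.2 (Or.inl rfl))
      refine IH _ _ ?_ ?_ w hwy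
      · refine Set.disjoint_insert_left.2 ⟨fun h => h.2 (Or.inr rfl), hd.mono_right (sdiff_subset.trans sdiff_subset)⟩
      · intro p hp x hx
        rcases hp with hp | hp
        · exact Finset.mem_erase.2 ⟨fun h => hnotv p (Or.inl (hsub hp)) (h ▸ hx), hS p (Or.inl hp.1.1) x hx⟩
        · rcases mem_insert_iff.1 hp with rfl | hp
          · exact howS x hx
          · exact Finset.mem_erase.2 ⟨fun h => hnotv p (Or.inr hp) (h ▸ hx), hS p (Or.inr hp) x hx⟩

/-- **H1′ ⇒ the node, induction form** (strong induction on the size of the support `S`).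
[cite: CibulkaHladkyLaCroixWagner2008, Thm. 1 (p. 2)] [cite: SempleWelsh2008, Conj. 1.1 (p. 2)] [cite: Linusson2011, Prop. 2.6] -/
theorem adjForestNoSq_fibre_of_twoCellBound_aux (hH : TwoCellBoundOn V) (n : ℕ) :
    ∀ {M u₀ : BondConfig V} (S : Finset V) {o v y : V}, S.card = n →
    Disjoint u₀ M → v ≠ y → (∀ g ∈ M ∪ u₀, ∀ w ∈ g, w ∈ S) →
    fibreCount M u₀ (forestEv V ∩ {ω | s(o, v) ∈ ω ∧ s(o, y) ∈ ω}) (forestEv V) ≤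
      fibreCount M u₀ (forestEv V ∩ {ω | s(o, v) ∈ ω}) (forestEv V ∩ {ω | s(o, y) ∈ ω}) := by
  induction n using Nat.strong_induction_on with
  | _ n IH =>
  intro M u₀ S o v y hn hd hvy hS
  have hu_sub : ∀ {ω : BondConfig V}, ω \ M = u₀ → u₀ ⊆ ω ∧ u₀ ⊆ ω ∆ M := fun {ω} hω =>
    ⟨fun x hx => by rw [← hω] at hx; exact hx.1, fun x hx => by
      rw [← hω] at hx; exact Set.mem_symmDiff.2 (Or.inl ⟨hx.1, hx.2⟩)⟩
  -- 0. diagonal pairs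
  by_cases hdiag : ∃ g ∈ M ∪ u₀, g.IsDiag
  · obtain ⟨g, hg, hgd⟩ := hdiag
    rw [fibreCount_eq_zero_of_forall M u₀ _ _ fun ω hω hA hB => by
      rcases hg with hgM | hgu
      · by_cases hgω : g ∈ ω
        · exact hA.1.1 g hgω hgd
        · exact hB.1 g (Set.mem_symmDiff.2 (Or.inr ⟨hgM, hgω⟩)) hgd
      · exact hA.1.1 g ((hu_sub hω).1 hgu) hgd]
    exact Nat.zero_le _
  push Not at hdiag
  have hMd : ∀ g ∈ M, ¬ g.IsDiag := fun g hg => hdiag g (Or.inl hg)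
  have hUd : ∀ g ∈ u₀, ¬ g.IsDiag := fun g hg => hdiag g (Or.inr hg)
  -- 1. `e` and `f` free
  by_cases heM : s(o, v) ∈ M
  swap
  · by_cases heu : s(o, v) ∈ u₀
    · have h1 : fibreCount M u₀ (forestEv V ∩ {ω | s(o, v) ∈ ω ∧ s(o, y) ∈ ω}) (forestEv V) =
          fibreCount M u₀ (forestEv V ∩ {ω | s(o, y) ∈ ω}) (forestEv V) :=
        fibreCount_congr_fibre _ _ fun ω hω => by
          have he : s(o, v) ∈ ω := (hu_sub hω).1 heu
          simp only [mem_inter_iff, mem_setOf_eq, he, true_and]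
      have h2 : fibreCount M u₀ (forestEv V ∩ {ω | s(o, v) ∈ ω}) (forestEv V ∩ {ω | s(o, y) ∈ ω}) =
          fibreCount M u₀ (forestEv V) (forestEv V ∩ {ω | s(o, y) ∈ ω}) :=
        fibreCount_congr_fibre _ _ fun ω hω => by
          have he : s(o, v) ∈ ω := (hu_sub hω).1 heu
          simp only [mem_inter_iff, mem_setOf_eq, he, and_true]
      rw [h1, h2, fibreCount_swap]
    · rw [fibreCount_eq_zero_of_forall M u₀ _ _ fun ω hω hA _ =>
        ((subset_union_of_fibre hω).1 hA.2.1).elim heM heu]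
      exact Nat.zero_le _
  by_cases hfM : s(o, y) ∈ M
  swap
  · by_cases hfu : s(o, y) ∈ u₀
    · have h1 : fibreCount M u₀ (forestEv V ∩ {ω | s(o, v) ∈ ω ∧ s(o, y) ∈ ω}) (forestEv V) =
          fibreCount M u₀ (forestEv V ∩ {ω | s(o, v) ∈ ω}) (forestEv V) :=
        fibreCount_congr_fibre _ _ fun ω hω => by
          have hf : s(o, y) ∈ ω := (hu_sub hω).1 hfu
          simp only [mem_inter_iff, mem_setOf_eq, hf, and_true]
      have h2 : fibreCount M u₀ (forestEv V ∩ {ω | s(o, v) ∈ ω}) (forestEv V ∩ {ω | s(o, y) ∈ ω}) =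
          fibreCount M u₀ (forestEv V ∩ {ω | s(o, v) ∈ ω}) (forestEv V) :=
        fibreCount_congr_fibre _ _ fun ω hω => by
          have hf : s(o, y) ∈ ω ∆ M := (hu_sub hω).2 hfu
          simp only [mem_inter_iff, mem_setOf_eq, hf, and_true]
      rw [h1, h2]
    · rw [fibreCount_eq_zero_of_forall M u₀ _ _ fun ω hω hA _ =>
        ((subset_union_of_fibre hω).1 hA.2.2).elim hfM hfu]
      exact Nat.zero_le _
  have hov : o ≠ v := fun h => hMd _ heM (Sym2.mk_isDiag_iff.2 h)
  have hoy : o ≠ y := fun h => hMd _ hfM (Sym2.mk_isDiag_iff.2 h)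
  have hoS : o ∈ S := hS _ (Or.inl heM) o (Sym2.mem_mk_left _ _)
  have hvS : v ∈ S := hS _ (Or.inl heM) v (Sym2.mem_mk_right _ _)
  have hyS : y ∈ S := hS _ (Or.inl hfM) y (Sym2.mem_mk_right _ _)
  -- 2. at or above the tight level: the tree level
  by_cases htight : 2 * S.card ≤ M.ncard + 2 * u₀.ncard + 2
  · exact adjForestNoSq_fibre_of_tight S hd hvy hS htight
  -- 3. degrees
  have hsumM := sum_card_filter_mem_eq (toFinite M).toFinset S (fun g hg => hMd g ((Set.Finite.mem_toFinset _).1 hg))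
    (fun g hg w hw => hS g (Or.inl ((Set.Finite.mem_toFinset _).1 hg)) w hw)
  have hsumU := sum_card_filter_mem_eq (toFinite u₀).toFinset S (fun g hg => hUd g ((Set.Finite.mem_toFinset _).1 hg))
    (fun g hg w hw => hS g (Or.inr ((Set.Finite.mem_toFinset _).1 hg)) w hw)
  have hcM : (toFinite M).toFinset.card = M.ncard := (Set.ncard_eq_toFinset_card M (toFinite M)).symm
  have hcU : (toFinite u₀).toFinset.card = u₀.ncard := (Set.ncard_eq_toFinset_card u₀ (toFinite u₀)).symm
  have hsum : ∑ w ∈ S, (((toFinite M).toFinset.filter fun g => w ∈ g).card +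
      2 * ((toFinite u₀).toFinset.filter fun g => w ∈ g).card) = 2 * M.ncard + 4 * u₀.ncard := by
    rw [Finset.sum_add_distrib, ← Finset.mul_sum, hsumM, hsumU, hcM, hcU]; ring
  -- the induction hypothesis one vertex down
  have IHz : ∀ z ∈ S, ∀ (N u : BondConfig V), Disjoint u N → (∀ g ∈ N ∪ u, ∀ w ∈ g, w ∈ S.erase z) →
      ∀ (o' v' y' : V), v' ≠ y' →
      fibreCount N u (forestEv V ∩ {ω | s(o', v') ∈ ω ∧ s(o', y') ∈ ω}) (forestEv V) ≤
        fibreCount N u (forestEv V ∩ {ω | s(o', v') ∈ ω}) (forestEv V ∩ {ω | s(o', y') ∈ ω}) := by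
    intro z hzS N u hd' hS' o' v' y' hv'y
    have hcardE : (S.erase z).card + 1 = S.card := Finset.card_erase_add_one hzS
    exact IH (S.erase z).card (by omega) (S.erase z) rfl hd' hv'y hS'
  -- 4. a far vertex of weighted degree at most two
  by_cases hfar : ∃ z ∈ S \ {o, v, y}, ((toFinite M).toFinset.filter fun g => z ∈ g).card +
      2 * ((toFinite u₀).toFinset.filter fun g => z ∈ g).card ≤ 2
  · obtain ⟨z, hz, hdegz⟩ := hfar
    have hzS : z ∈ S := (Finset.mem_sdiff.1 hz).1
    have hzT : z ∉ ({o, v, y} : Finset V) := (Finset.mem_sdiff.1 hz).2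
    simp only [Finset.mem_insert, Finset.mem_singleton, not_or] at hzT; obtain ⟨hzo, hzv, hzy⟩ := hzT
    exact node_of_farVertex_le_two (fun N u hd' hS' => IHz z hzS N u hd' hS' o v y hvy) hd hS hdiag heM hfM hvy hzo hzv hzy hdegz
  push Not at hfar
  -- 5. the hub of weighted degree two
  have h2o := two_le_card_filter heM hfM hvy
  have hef : s(o, v) ≠ s(o, y) := fun h' => hvy (Sym2.congr_right.1 h')
  by_cases hdo : ((toFinite M).toFinset.filter fun g => o ∈ g).card + 2 * ((toFinite u₀).toFinset.filter fun g => o ∈ g).card ≤ 2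
  · have hUo := isolated_of_card_filter_eq_zero (M := u₀) (z := o) (by omega)
    obtain ⟨a', b', -, -, hab, haM, hbM, honly⟩ := exists_of_card_filter_eq_two (z := o) hMd (by omega)
    have cover : ∀ g ∈ M, o ∈ g → g = s(o, v) ∨ g = s(o, y) := by
      intro g hg hog
      rcases honly _ heM (Sym2.mem_mk_left _ _) with he' | he' <;>
        rcases honly _ hfM (Sym2.mem_mk_left _ _) with hf' | hf' <;>
          rcases honly g hg hog with hg' | hg'
      · exact absurd (he'.trans hf'.symm) hef
      · exact absurd (he'.trans hf'.symm) hef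
      · exact Or.inl (hg'.trans he'.symm)
      · exact Or.inr (hg'.trans hf'.symm)
      · exact Or.inr (hg'.trans hf'.symm)
      · exact Or.inl (hg'.trans he'.symm)
      · exact absurd (he'.trans hf'.symm) hef
      · exact absurd (he'.trans hf'.symm) hef
    have hM₀ : insert s(o, y) (M \ {s(o, y)}) = M := by rw [insert_sdiff_singleton, insert_eq_of_mem hfM]
    have ho : ∀ g ∈ M \ {s(o, y)} ∪ u₀, o ∈ g → g = s(o, v) := by
      intro g hg hog
      rcases hg with hg | hg
      · rcases cover g hg.1 hog with h | h
        · exact h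
        · exact absurd (mem_singleton_iff.2 h) hg.2
      · exact absurd hog (hUo g hg)
    have key := adjForestNoSq_fibre_of_hubDegTwo (u₀ := u₀) hoy (fun h => h.2 rfl)
      (show s(o, v) ∈ M \ {s(o, y)} from ⟨heM, fun h => hef (mem_singleton_iff.1 h)⟩) hef ho
    rw [hM₀] at key
    exact key
  -- 6. an end of weighted degree at most two
  by_cases hdv : ((toFinite M).toFinset.filter fun g => v ∈ g).card + 2 * ((toFinite u₀).toFinset.filter fun g => v ∈ g).card ≤ 2
  · exact node_of_lowEnd (fun N u hd' hS' v' hv' => IHz v hvS N u hd' hS' o v' y hv') hd hS hdiag heM hfM hov hoy hvy hdv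
  by_cases hdy : ((toFinite M).toFinset.filter fun g => y ∈ g).card + 2 * ((toFinite u₀).toFinset.filter fun g => y ∈ g).card ≤ 2
  · have key := node_of_lowEnd (o := o) (v := y) (y := v) (fun N u hd' hS' v' hv' => IHz y hyS N u hd' hS' o v' v hv')
      hd hS hdiag hfM heM hoy hov hvy.symm hdy
    have hset : {ω : BondConfig V | s(o, y) ∈ ω ∧ s(o, v) ∈ ω} = {ω | s(o, v) ∈ ω ∧ s(o, y) ∈ ω} := by
      ext ω; simp only [mem_setOf_eq]; tauto
    rw [hset, fibreCount_swap M u₀ (forestEv V ∩ {ω | s(o, y) ∈ ω})] at key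
    exact key
  -- 7. all weighted degrees ≥ 3: the counting lemma gives a weighted-degree-3 vertex not joined to `o`
  set fdeg : V → ℕ := fun w => ((toFinite M).toFinset.filter fun g => w ∈ g).card +
    2 * ((toFinite u₀).toFinset.filter fun g => w ∈ g).card with hfdeg
  have hdeg3 : ∀ w ∈ S, 3 ≤ fdeg w := by
    intro w hw
    by_cases hwo : w = o
    · subst hwo; simp only [hfdeg]; omega
    by_cases hwv : w = v
    · subst hwv; simp only [hfdeg]; omega
    by_cases hwy : w = y
    · subst hwy; simp only [hfdeg]; omega
    have hw' : w ∈ S \ {o, v, y} := Finset.mem_sdiff.2 ⟨hw, by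
      simp only [Finset.mem_insert, Finset.mem_singleton, not_or]; exact ⟨hwo, hwv, hwy⟩⟩
    have := hfar w hw'
    simp only [hfdeg]; omega
  have hsum' : ∑ w ∈ S, fdeg w + 6 ≤ 4 * S.card := by
    have : ∑ w ∈ S, fdeg w = 2 * M.ncard + 4 * u₀.ncard := hsum
    omega
  -- the vertices joined to `o`
  set nbr := (S.erase o).filter fun z => s(o, z) ∈ M ∨ s(o, z) ∈ u₀ with hnbr_def
  have hnbr : nbr.card ≤ fdeg o := by
    have hinj : Set.InjOn (fun z : V => s(o, z)) ↑nbr := fun z _ z' _ h => Sym2.congr_right.1 h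
    have hmaps : ∀ z ∈ nbr, s(o, z) ∈ ((toFinite M).toFinset.filter fun g => o ∈ g) ∪ ((toFinite u₀).toFinset.filter fun g => o ∈ g) := by
      intro z hz
      rcases (Finset.mem_filter.1 hz).2 with h | h
      · exact Finset.mem_union_left _ (Finset.mem_filter.2 ⟨(Set.Finite.mem_toFinset _).2 h, Sym2.mem_mk_left _ _⟩)
      · exact Finset.mem_union_right _ (Finset.mem_filter.2 ⟨(Set.Finite.mem_toFinset _).2 h, Sym2.mem_mk_left _ _⟩)
    have h1 := Finset.card_le_card_of_injOn (fun z : V => s(o, z)) hmaps hinj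
    have h2 := Finset.card_union_le ((toFinite M).toFinset.filter fun g => o ∈ g) ((toFinite u₀).toFinset.filter fun g => o ∈ g)
    simp only [hfdeg]; omega
  obtain ⟨z, hzS, hzo, hz3, hznbr⟩ := exists_weight_three_outside S nbr o fdeg hoS hdeg3 hsum' hnbr
  have hoz : s(o, z) ∉ M ∪ u₀ := fun h => hznbr (Finset.mem_filter.2 ⟨Finset.mem_erase.2 ⟨hzo, hzS⟩, h⟩)
  have hzv : z ≠ v := fun h => hoz (Or.inl (h ▸ heM))
  have hzy : z ≠ y := fun h => hoz (Or.inl (h ▸ hfM))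
  exact node_of_farVertex_three hH (fun N u hd' hS' => IHz z hzS N u hd' hS' o v y hvy) hd hS hdiag heM hfM hvy hzo hzv hzy hoz hz3

/-- **CONJECTURE H1′ IMPLIES THE NODE on the vertex type `V`.**  If the two-cell bound `TwoCellBoundOn V` holds, then the square-free
adjacent forest Rayleigh node `AdjForestRayleighNoSqOn V` holds (every fibre, every level).
[cite: SempleWelsh2008, Conj. 1.1 (p. 2)] [cite: CibulkaHladkyLaCroixWagner2008, Thm. 1 (p. 2)] [cite: Linusson2011, Prop. 2.6] -/
theorem adjForestRayleighNoSqOn_of_twoCellBound (hH : TwoCellBoundOn V) : AdjForestRayleighNoSqOn V := by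
  intro M u₀ hd o v y hvy
  exact adjForestNoSq_fibre_of_twoCellBound_aux hH _ (Finset.univ : Finset V) rfl hd hvy (fun _ _ w _ => Finset.mem_univ w)

/-- **H1′ on all finite types ⇒ (♣)⁰** (`AdjForestRayleighNoSqPos`), hence — by the lineage's unconditional arrows — the whole chain
(♣) ⇒ FRM ⇒ (A′) ⇒ (A) ⇒ (B′) ⇒ (B) of the FK sub-lane. [cite: SempleWelsh2008, Conj. 1.1 (p. 2)] [cite: Grimmett2006, Thm. 3.8 (p. 43)] -/
theorem adjForestRayleighNoSqPos_of_twoCellBoundPos (hH : TwoCellBoundPos) : AdjForestRayleighNoSqPos := fun n =>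
  adjForestRayleighNoSqOn_of_twoCellBound (hH n)

end Main

end FK
end Summit.CriticalPhenomena.PercolationContinuityZ3.Theorems

end
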